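import Literature.NumberTheory.LFunctions.PsiOscillationFromZero
import HarnessLib

/-!
# LANDAU for the half-line Chebyshev bias — endgame inequality for a double-pole kernel

Cell `pub-rhpf` (mechanism/rigidity campaign; **no RH claims**), CAND SEAT 7 gen 8, CASE-DAG v6 §6
kernel target LANDAU. A self-contained complex-arithmetic lemma: the `1/s²` analogue of
`Literature.NumberTheory.LFunctions.re_endgame_le` (the endgame of Montgomery–Vaughan's proof of
Thm. 15.3), used by `PfPersistenceHalfLineBiasLandau` for the statistic
`B(x) = Σ_{n≤x} Λ(n) n^{-1/2} log(x/n) − 4√x` whose Mellin kernel `(ζ₁'/ζ₁(s + 1/2) + 4s + 2)/s²`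
has a DOUBLE pole weight `1/s²` at the shifted zero. With `s = ρ₀ + u`, `w = −η ρ₀²/|ρ₀|²`:
`Re( c/u + η q + w (c/(s − Re ρ₀) + η (m/u + D)/s²) ) ≤ (c − 1/|ρ₀|²)/u + O(1)`, the `O(1)`
explicit in `|q|, |D|, m, |ρ₀|, Im ρ₀`. RH-free, sorry-free.

References: [MontgomeryVaughan2007] Montgomery–Vaughan, *Multiplicative Number Theory I*, §15.1.
-/

noncomputable section

-- the sub-problem path RiemannHypothesis/RiemannHypothesis duplicates a namespace (D-0017)
set_option linter.dupNamespace false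

open Complex Filter Topology Set Metric

namespace Summit.RiemannHypothesis.RiemannHypothesis.Theorems.PfPersistenceHalfLineBiasEndgame

/-! ## The endgame inequality for a double-pole kernel -/

/-- **Endgame with a `1/s²` kernel.** With `s = ρ₀ + u` (`0 < u ≤ 1`, `Im ρ₀ ≠ 0`),
`w = −η ρ₀²/|ρ₀|²` (so `|w| = 1` and `w/ρ₀² = −η/|ρ₀|²`), `|q| ≤ C₁`, `|D| ≤ B₀`, `m ≥ 1`, `c ≥ 0`:
`Re( c/u + η q + w (c/(s − Re ρ₀) + η (m/u + D)/s²) ) ≤ (c − 1/|ρ₀|²)/u + O(1)` with the explicit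
`O(1) = C₁ + c/|Im ρ₀| + m(2|ρ₀| + 1)/(Im ρ₀)⁴ + B₀/(Im ρ₀)²`.
[cite: MontgomeryVaughan2007, §15.1 (proof of Thm. 15.3), adapted to a double pole] -/
theorem re_endgame_sq_le {η c u C₁ B₀ : ℝ} {m : ℕ} {ρ₀ q D s w : ℂ} (hη : η = 1 ∨ η = -1)
    (hu : 0 < u) (hu1 : u ≤ 1) (hm : 1 ≤ m) (hc : 0 ≤ c) (hγ : ρ₀.im ≠ 0) (hs : s = ρ₀ + u)
    (hw : w = -η * ρ₀ ^ 2 / ((‖ρ₀‖ : ℂ) ^ 2)) (hq : ‖q‖ ≤ C₁) (hD : ‖D‖ ≤ B₀) :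
    ((c / u : ℂ) + η * q + w * (c / (s - (ρ₀.re : ℂ)) + η * (((m : ℂ) / u + D) / s ^ 2))).re ≤
      (c - 1 / ‖ρ₀‖ ^ 2) / u +
        (C₁ + c / |ρ₀.im| + m * (2 * ‖ρ₀‖ + 1) / ρ₀.im ^ 4 + B₀ / ρ₀.im ^ 2) := by
  have hρ0 : ρ₀ ≠ 0 := by rintro rfl; exact hγ (by simp)
  set γ : ℝ := ρ₀.im with hγdef
  have hγ0 : 0 < |γ| := abs_pos.2 hγ
  have hγ2p : 0 < γ ^ 2 := by rw [← (show Even 2 by norm_num).pow_abs]; exact pow_pos hγ0 2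
  have hγ4p : 0 < γ ^ 4 := by rw [← (show Even 4 by norm_num).pow_abs]; exact pow_pos hγ0 4
  have hρn : 0 < ‖ρ₀‖ := norm_pos_iff.2 hρ0
  have hρnC : ((‖ρ₀‖ : ℝ) : ℂ) ≠ 0 := ofReal_ne_zero.2 hρn.ne'
  have hηsq : η ^ 2 = 1 := by rcases hη with rfl | rfl <;> norm_num
  have hηabs : |η| = 1 := by rcases hη with rfl | rfl <;> norm_num
  have hw1 : ‖w‖ = 1 := by
    rw [hw, norm_div, norm_mul, norm_neg, Complex.norm_real, Real.norm_eq_abs, hηabs, one_mul,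
      norm_pow, norm_pow, Complex.norm_real, Real.norm_eq_abs, abs_of_pos hρn,
      div_self (pow_ne_zero 2 hρn.ne')]
  have hsim : s.im = γ := by rw [hs]; simp [hγdef]
  have hγρ : |γ| ≤ ‖ρ₀‖ := Complex.abs_im_le_norm ρ₀
  have hγs : |γ| ≤ ‖s‖ := by rw [← hsim]; exact Complex.abs_im_le_norm s
  have hs0 : s ≠ 0 := by intro h; rw [h, norm_zero] at hγs; linarith
  have hsn : 0 < ‖s‖ := norm_pos_iff.2 hs0
  have hsb : |γ| ≤ ‖s - (ρ₀.re : ℂ)‖ := by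
    have : (s - (ρ₀.re : ℂ)).im = γ := by rw [sub_im, hsim, ofReal_im, sub_zero]
    rw [← this]; exact Complex.abs_im_le_norm _
  have hsb0 : s - (ρ₀.re : ℂ) ≠ 0 := by intro h; rw [h, norm_zero] at hsb; linarith
  have huC : (u : ℂ) ≠ 0 := ofReal_ne_zero.2 hu.ne'
  -- T1: `Re(c/u) = c/u`
  have T1 : ((c / u : ℂ)).re = c / u := by rw [← ofReal_div, ofReal_re]
  -- T2: `Re(η q) ≤ C₁`
  have T2 : ((η : ℂ) * q).re ≤ C₁ := by
    rw [re_ofReal_mul]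
    have h1 : |q.re| ≤ C₁ := (Complex.abs_re_le_norm q).trans hq
    have h2 : |η * q.re| ≤ C₁ := by rw [abs_mul, hηabs, one_mul]; exact h1
    exact (le_abs_self _).trans h2
  -- T3: `Re(w c/(s − Re ρ₀)) ≤ c/|γ|`
  have T3 : (w * (c / (s - (ρ₀.re : ℂ)))).re ≤ c / |γ| := by
    refine (Complex.re_le_norm _).trans ?_
    rw [norm_mul, hw1, one_mul, norm_div, Complex.norm_real, Real.norm_eq_abs, abs_of_nonneg hc]
    exact div_le_div_of_nonneg_left hc hγ0 hsb
  -- T4a: the double-pole term, `w/s² = w/ρ₀² + O(u)` and `w/ρ₀² = −η/|ρ₀|²`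
  have hwρ : w / ρ₀ ^ 2 = ((-η / ‖ρ₀‖ ^ 2 : ℝ) : ℂ) := by
    have h1 : -(η : ℂ) * ρ₀ ^ 2 / ((‖ρ₀‖ : ℂ) ^ 2) / ρ₀ ^ 2 = -(η : ℂ) / ((‖ρ₀‖ : ℂ) ^ 2) := by
      field_simp
    rw [hw, h1]
    push_cast
    ring
  have hdiff : ‖w / s ^ 2 - w / ρ₀ ^ 2‖ ≤ u * (2 * ‖ρ₀‖ + 1) / γ ^ 4 := by
    have h1 : w / s ^ 2 - w / ρ₀ ^ 2 = w * ((ρ₀ ^ 2 - s ^ 2) / (s ^ 2 * ρ₀ ^ 2)) := by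
      field_simp
    rw [h1, norm_mul, hw1, one_mul, norm_div, norm_mul, norm_pow, norm_pow]
    have h2 : ‖ρ₀ ^ 2 - s ^ 2‖ ≤ u * (2 * ‖ρ₀‖ + 1) := by
      have e : ρ₀ ^ 2 - s ^ 2 = -(u : ℂ) * (2 * ρ₀ + u) := by rw [hs]; ring
      rw [e, norm_mul, norm_neg, Complex.norm_real, Real.norm_eq_abs, abs_of_pos hu]
      have h22 : ‖2 * ρ₀ + (u : ℂ)‖ ≤ 2 * ‖ρ₀‖ + 1 := by
        refine (norm_add_le _ _).trans ?_
        have : ‖(2 : ℂ) * ρ₀‖ = 2 * ‖ρ₀‖ := by rw [norm_mul]; simp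
        rw [this, Complex.norm_real, Real.norm_eq_abs, abs_of_pos hu]
        linarith
      exact mul_le_mul_of_nonneg_left h22 hu.le
    have h3 : γ ^ 4 ≤ ‖s‖ ^ 2 * ‖ρ₀‖ ^ 2 := by
      have a1 : γ ^ 2 ≤ ‖s‖ ^ 2 := by
        rw [← sq_abs]; exact pow_le_pow_left₀ (abs_nonneg _) hγs 2
      have a2 : γ ^ 2 ≤ ‖ρ₀‖ ^ 2 := by
        rw [← sq_abs]; exact pow_le_pow_left₀ (abs_nonneg _) hγρ 2
      calc γ ^ 4 = γ ^ 2 * γ ^ 2 := by ring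
        _ ≤ ‖s‖ ^ 2 * ‖ρ₀‖ ^ 2 := mul_le_mul a1 a2 (sq_nonneg _) (sq_nonneg _)
    calc ‖ρ₀ ^ 2 - s ^ 2‖ / (‖s‖ ^ 2 * ‖ρ₀‖ ^ 2)
        ≤ u * (2 * ‖ρ₀‖ + 1) / (‖s‖ ^ 2 * ‖ρ₀‖ ^ 2) := by gcongr
      _ ≤ u * (2 * ‖ρ₀‖ + 1) / γ ^ 4 := div_le_div_of_nonneg_left (by positivity) hγ4p h3
  have T4a : (w * ((η : ℂ) * ((m : ℂ) / u / s ^ 2))).re ≤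
      -(m / (u * ‖ρ₀‖ ^ 2)) + m * (2 * ‖ρ₀‖ + 1) / γ ^ 4 := by
    have h1 : w * ((η : ℂ) * ((m : ℂ) / u / s ^ 2)) = ((η * m / u : ℝ) : ℂ) * (w / s ^ 2) := by
      push_cast
      field_simp
    rw [h1, re_ofReal_mul, show w / s ^ 2 = w / ρ₀ ^ 2 + (w / s ^ 2 - w / ρ₀ ^ 2) by ring, add_re,
      mul_add]
    have hre : (w / ρ₀ ^ 2).re = -η / ‖ρ₀‖ ^ 2 := by rw [hwρ, ofReal_re]
    rw [hre]
    have h2 : η * m / u * (-η / ‖ρ₀‖ ^ 2) = -(η ^ 2 * (m / (u * ‖ρ₀‖ ^ 2))) := by ring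
    rw [h2, hηsq, one_mul]
    have h3 : |η * m / u * (w / s ^ 2 - w / ρ₀ ^ 2).re| ≤ m * (2 * ‖ρ₀‖ + 1) / γ ^ 4 := by
      rw [abs_mul]
      have h4 : |η * m / u| = m / u := by
        rw [abs_div, abs_mul, hηabs, one_mul, abs_of_nonneg (Nat.cast_nonneg m), abs_of_pos hu]
      rw [h4]
      calc m / u * |(w / s ^ 2 - w / ρ₀ ^ 2).re|
          ≤ m / u * (u * (2 * ‖ρ₀‖ + 1) / γ ^ 4) := by
            gcongr; exact (Complex.abs_re_le_norm _).trans hdiff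
        _ = m * (2 * ‖ρ₀‖ + 1) / γ ^ 4 := by field_simp
    linarith [(abs_le.1 h3).2]
  -- T4b: the regular part
  have T4b : (w * ((η : ℂ) * (D / s ^ 2))).re ≤ B₀ / γ ^ 2 := by
    refine (Complex.re_le_norm _).trans ?_
    rw [norm_mul, hw1, one_mul, norm_mul, Complex.norm_real, Real.norm_eq_abs, hηabs, one_mul,
      norm_div, norm_pow]
    have hγ2 : γ ^ 2 ≤ ‖s‖ ^ 2 := by
      rw [← sq_abs]; exact pow_le_pow_left₀ (abs_nonneg _) hγs 2
    calc ‖D‖ / ‖s‖ ^ 2 ≤ B₀ / ‖s‖ ^ 2 := by gcongr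
      _ ≤ B₀ / γ ^ 2 := div_le_div_of_nonneg_left ((norm_nonneg D).trans hD) hγ2p hγ2
  -- assemble
  have hsplit : (c / u : ℂ) + η * q + w * (c / (s - (ρ₀.re : ℂ)) + η * (((m : ℂ) / u + D) / s ^ 2)) =
      (c / u : ℂ) + η * q + w * (c / (s - (ρ₀.re : ℂ))) + w * ((η : ℂ) * ((m : ℂ) / u / s ^ 2)) +
        w * ((η : ℂ) * (D / s ^ 2)) := by
    ring
  rw [hsplit, add_re, add_re, add_re, add_re, T1]
  have hm1 : (1 : ℝ) / (u * ‖ρ₀‖ ^ 2) ≤ m / (u * ‖ρ₀‖ ^ 2) := by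
    gcongr; exact_mod_cast hm
  have hkey : (c - 1 / ‖ρ₀‖ ^ 2) / u = c / u - 1 / (u * ‖ρ₀‖ ^ 2) := by
    field_simp
  linarith [T2, T3, T4a, T4b, hm1, hkey]

end Summit.RiemannHypothesis.RiemannHypothesis.Theorems.PfPersistenceHalfLineBiasEndgame

end
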